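import Summits.HodgeConjecture.HodgeConjecture.Theorems.LimitExtensionMiddleDivisorSupportSuffices
import Literature.AlgebraicGeometry.HodgeTheory.GysinKernelSplit
import Literature.AlgebraicGeometry.HodgeTheory.HodgeRiemannPolarizabilityProofs

/-!
# Route LimitExtension · `MiddleDivisorSupportSuffices` (stmt-HodgeConjecture-10865):
# the item from TWO leaves — Hodge III Prop. 8.2.7 and the route's own pencil crux

The item `MiddleDivisorSupportSuffices := HodgeModels (inline) → MiddleDivisorSupport →
HodgeConjecture` (Thomas 2005, Prop. 2 / de Cataldo–Migliorini 2009 §4 Prop. 4.5: induction on the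
dimension) is proved in the tree modulo hypotheses by `middleDivisorSupportSuffices_of_facts`
(`Theorems/LimitExtensionMiddleDivisorSupportSuffices`): Deligne *Hodge III* Cor. 8.2.8 (`hD`),
Voisin 2025 Cor. 2.12 (`hV`, the Hodge-class lift along Gysin sums) and the Lefschetz-pencil step
below the middle (`hPen`). The earlier record `middleDivisorSupportSuffices_of_threeLeaves`
(`Theorems/LimitExtensionMiddleDivisorSupportSufficesThreeLeaves`) pinned these to three ledger
objects: Prop. 8.2.7 (`Deligne1974_ker_pullback_eq_ker_pullback_resolution`), the polarizability
`smoothProjective_hodgeStructure_isPolarizable` (Hodge–Riemann) and route `NodalSupport`'s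
`PencilReduction` (stmt-HodgeConjecture-1083).

Since then (2026-08-16) the polarizability has been DISCHARGED in `Literature`:
`smoothProjective_hodgeStructure_isPolarizable_holds` and, with it, Voisin's lift
`Voisin2025_hodgeClass_lift_complexGysin_holds` (`HodgeRiemannPolarizabilityProofs`: hard
Lefschetz, the Lefschetz decomposition over `ℚ` and the Hodge–Riemann bilinear relations, all
theorems of the tree). And the pencil step is now a crux OF THIS ROUTE: `LimitExtension.PencilReduction`
(stmt-HodgeConjecture-1083, rank 6; definitionally the verbatim hypothesis `hPen` of
`middleDivisorSupportSuffices_of_facts` and of route `NodalSupport`'s decl of the same name).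

This file records the resulting state: the item follows from exactly TWO open ledger objects,

* `h827 : Deligne1974_ker_pullback_eq_ker_pullback_resolution` — Deligne, *Hodge III*, Prop. 8.2.7
  in Čech form (named fact, file `GysinKernelSplit`; its discharge is mixed Hodge theory:
  `MixedHodgeStructureOfPair.existsDeligne` with Prop. 8.2.5, file `GysinKernelSplitProofs`), and
* `hPen : PencilReduction` — this route's crux stmt-HodgeConjecture-1083,

as `middleDivisorSupportSuffices_of_twoLeaves h827 hPen : MiddleDivisorSupportSuffices`.

STATUS: CONDITIONAL (supports the item, does not close it). Why neither leaf can be bypassed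
(diagnosis shared by the item's prover seats): in the middle degree `2p = dim X` the support that
`MiddleDivisorSupport` provides is an ARBITRARY proper Zariski-closed subset, and descending a class
supported there to Gysin images from resolutions of its components is the weight statement
Prop. 8.2.7 (it fails for non-algebraic configurations, so it is not a consequence of the tree's
topology; only its one-closed-immersion case is, `….of_isClosedImmersion`); below the middle, hard
Lefschetz returns a class only through the inverse Lefschetz operator (standard conjecture B) and
products `X × ℙ¹` feed the pencil step with hyperplane sections of the same dimension as `X`
(circular), so the pencil step on `X` itself is needed. CLOSING RECIPE: once
`h827_holds : Deligne1974_ker_pullback_eq_ker_pullback_resolution` is a theorem and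
stmt-HodgeConjecture-1083 is closed (route link `PencilReduction_holds : PencilReduction`), append
`theorem middleDivisorSupportSuffices_proof : MiddleDivisorSupportSuffices :=
middleDivisorSupportSuffices_of_twoLeaves h827_holds PencilReduction_holds`
(`--workitem stmt-HodgeConjecture-10865`) and release the item `--by` it. (Items-only alternative,
the planner's hold recipe: `middleDivisorSupportSuffices_of_nodalSupport DivisorInduction_holds
PencilReduction_holds`, stmt-HodgeConjecture-1082 consuming `h827` itself.)

## References

* [Thomas2005Nodes] R. P. Thomas, Nodes and the Hodge conjecture, J. Algebraic Geom. 14 (2005),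
  Prop. 2 and its proof.
* [DecataldoMigliorini2009] M. A. de Cataldo, L. Migliorini, §4 Prop. 4.5 (arXiv:0711.1307).
* [DeligneHodgeIII1974] P. Deligne, Théorie de Hodge III, Publ. Math. IHÉS 44 (1974), Prop. 8.2.7,
  Cor. 8.2.8.
* [Voisin2025] C. Voisin, Hodge and generalized Hodge conjectures, coniveau and algebraic cycles,
  J. Open Math. Probl. 1 (2025), Cor. 2.12.
* [VoisinHodgeI2002] C. Voisin, Hodge Theory and Complex Algebraic Geometry I (2002), Thm. 6.32,
  §7.1.2.
-/

-- `Summit.HodgeConjecture.HodgeConjecture.Theorems` is the mandated namespace (single-conjunct summit: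
-- Sub = Summit), which `linter.dupNamespace` flags; off tree-wide in the lakefile, restated here so
-- stand-alone elaboration is warning-free too.
set_option linter.dupNamespace false

noncomputable section

namespace Summit.HodgeConjecture.HodgeConjecture.Theorems

open Summit.HodgeConjecture.HodgeConjecture.Theses.LimitExtension
open Literature.AlgebraicGeometry.HodgeTheory Literature.AlgebraicGeometry.Motives

/-- **`MiddleDivisorSupportSuffices` from its two remaining leaves** (route `LimitExtension`, item
stmt-HodgeConjecture-10865): Deligne *Hodge III* Prop. 8.2.7 (`h827`, the named fact
`Deligne1974_ker_pullback_eq_ker_pullback_resolution`) and the Lefschetz-pencil step below the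
middle (`hPen`, this route's crux `PencilReduction`, stmt-HodgeConjecture-1083). Proof: Prop. 8.2.7
gives Cor. 8.2.8 (`Deligne1974_ker_restrictCompl_eq_iSup_range_complexGysin_holds_of`); Voisin's
lift of Hodge classes along Gysin sums is now the THEOREM
`Voisin2025_hodgeClass_lift_complexGysin_holds` (polarizability of the Hodge structure of a smooth
projective variety, `smoothProjective_hodgeStructure_isPolarizable_holds`, from hard Lefschetz and
the Hodge–Riemann bilinear relations); both feed Thomas's induction on the dimension
`middleDivisorSupportSuffices_of_facts` together with `hPen` (hyperplane sections above the middle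
by Andreotti–Frankel, `MiddleDivisorSupport` plus divisor descent in the middle, the pencil step
below). CONDITIONAL on the named fact `h827` and on the crux item; this is the item's closing term
once both are theorems.
[cite: DeligneHodgeIII1974, Prop. 8.2.7 and Cor. 8.2.8] [cite: Voisin2025, Cor. 2.12]
[cite: VoisinHodgeI2002, Thm. 6.32 and §7.1.2] [cite: Thomas2005Nodes, Prop. 2 (proof)]
[cite: DecataldoMigliorini2009, §4 Prop. 4.5] -/
theorem middleDivisorSupportSuffices_of_twoLeaves
    (h827 : Deligne1974_ker_pullback_eq_ker_pullback_resolution)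
    (hPen : PencilReduction) :
    MiddleDivisorSupportSuffices :=
  middleDivisorSupportSuffices_of_facts
    (Deligne1974_ker_restrictCompl_eq_iSup_range_complexGysin_holds_of h827)
    Voisin2025_hodgeClass_lift_complexGysin_holds hPen

/-- **The item modulo Prop. 8.2.7, as an implication between route decls**: Deligne *Hodge III*
Prop. 8.2.7 alone turns this route's pencil crux `PencilReduction` (stmt-HodgeConjecture-1083) into
the glue item `MiddleDivisorSupportSuffices` (stmt-HodgeConjecture-10865) — the form in which the
dependency is read off by the route's bookkeeping (one named fact, one crux).
[cite: DeligneHodgeIII1974, Prop. 8.2.7] [cite: Thomas2005Nodes, Prop. 2 (proof)] -/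
theorem pencilReduction_imp_middleDivisorSupportSuffices_of_deligne827
    (h827 : Deligne1974_ker_pullback_eq_ker_pullback_resolution) :
    PencilReduction → MiddleDivisorSupportSuffices :=
  fun hPen ↦ middleDivisorSupportSuffices_of_twoLeaves h827 hPen

end Summit.HodgeConjecture.HodgeConjecture.Theorems

end
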